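import Literature.Computability.MetaComplexity.LinearMapResolutionWidthProofs
import HarnessLib

/-!
# The `Res(k)` rung for expanding linear systems, II: peeling orders and the solving map

Support file for `stmt-PneNP-11443`. For a family `I` of rows of a system `E : Fin m → LinEqMod 2 n`
all of whose nonempty subfamilies have a unique-neighbour variable (e.g. any family of at most `r`
rows of a boundary expander), we construct

* PEELING ORDERS (`IsPeeling E I L`): a list `L` of (row, pivot) pairs enumerating `I`, the pivot
  of each entry lying in the support of its row and in the support of NO EARLIER row (lower
  triangular form obtained by repeatedly peeling a unique-neighbour variable and putting its row
  LAST);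
* `exists_isPeeling_avoiding`: for any set `W` of variables, a peeling order with at most `|W|/c`
  pivots inside `W` when every subfamily `I' ⊆ I` has `|∂I'| ≥ c|I'|` (peel pivots outside `W` as
  long as possible; once `∂I' ⊆ W`, `|I'| ≤ |W|/c`);
* the SOLVING MAP `solve E L σ`: process the rows of `L` in order, flipping the pivot of every
  violated row; it fixes every row of `I` (`holds_solve`), changes only pivots
  (`solve_apply_of_forall_ne`), and `solve E L y = x` whenever `x` solves the rows of `I` and `y`
  agrees with `x` off the pivots (`solve_eq_of_agree_off_pivots`) — so `solve` is exactly
  `2^{|I|}`-to-one onto the solutions.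

This is the value part of the expansion-preserving random restriction (Alekhnovich 2011, §3):
assigning the closure rows by `solve` of uniformly random bits makes the values on pivot-free
("clean") variable sets genuinely independent fair coins.
-/

namespace Summit.PneNP.PneNP.Theorems.ResKRestriction

open Finset Literature.Computability.Complexity Literature.Computability.MetaComplexity

variable {m n : ℕ}

/-! ### One more `𝔽₂` fact: flipping a support variable toggles the equation -/

/-- Flipping a variable in the support of an equation over `𝔽₂` toggles its truth value
(`B = 1` sum-encoding). [Ben-Sasson–Wigderson 2001, §4.2] [folklore] -/
theorem holds_update_not_iff {E₀ : LinEqMod 2 n} (σ : ℕ → Bool) {j : Fin n} (hj : j ∈ E₀.supp) :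
    E₀.Holds (blockVals 2 1 n (Function.update σ j (!σ j))) ↔ ¬ E₀.Holds (blockVals 2 1 n σ) := by
  refine ⟨fun h hσ => ?_, holds_blockVals_update_not E₀ σ hj⟩
  -- flipping twice returns to `σ`; the second flip repairs the (supposedly violated) flipped row
  have key := holds_blockVals_update_not E₀ (Function.update σ j (!σ j)) hj
  by_cases h' : E₀.Holds (blockVals 2 1 n (Function.update σ j (!σ j)))
  · -- both `σ` and its flip satisfy the equation: compare the two sums
    unfold LinEqMod.Holds at hσ h'
    rw [blockVals_two_one_update] at h'
    rw [← Finset.add_sum_erase _ _ (Finset.mem_univ j)] at hσ h'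
    have hrest : ∑ j' ∈ univ.erase j, E₀.1 j' *
        Function.update (blockVals 2 1 n σ) j (if (!σ j) = true then 1 else 0) j' =
        ∑ j' ∈ univ.erase j, E₀.1 j' * blockVals 2 1 n σ j' :=
      Finset.sum_congr rfl fun j' hj' => by rw [Function.update_of_ne (Finset.ne_of_mem_erase hj')]
    rw [hrest, Function.update_self] at h'
    have ha : E₀.1 j = 1 :=
      (by decide : ∀ a : ZMod 2, a ≠ 0 → a = 1) _ (by simpa [LinEqMod.supp] using hj)
    rw [ha, one_mul, blockVals_two_one_apply] at hσ
    rw [ha, one_mul] at h'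
    rw [← h'] at hσ
    have : (if σ j = true then (1 : ZMod 2) else 0) = (if (!σ j) = true then (1 : ZMod 2) else 0) :=
      add_right_cancel hσ
    cases hb : σ j <;> simp [hb] at this
  · exact h' h

/-! ### Peeling orders -/

/-- `IsPeeling E I L`: the list `L` of (row, pivot) pairs is a PEELING ORDER of the row family `I`:
built from the empty list by appending a pair `(i, v)` with `i` a new row, `v` in the support of
row `i` and in the support of no row already listed. [Alekhnovich 2011, §3 (local consistency via
unique neighbours); Ben-Sasson–Wigderson 2001, §5 (peeling)] [folklore] -/
inductive IsPeeling (E : Fin m → LinEqMod 2 n) : Finset (Fin m) → List (Fin m × Fin n) → Prop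
  /-- the empty family -/
  | nil : IsPeeling E ∅ []
  /-- append a new row with a fresh pivot -/
  | snoc {I : Finset (Fin m)} {L : List (Fin m × Fin n)} (i : Fin m) (v : Fin n)
      (hL : IsPeeling E I L) (hi : i ∉ I) (hv : v ∈ (E i).supp)
      (hfresh : ∀ i' ∈ I, v ∉ (E i').supp) : IsPeeling E (insert i I) (L ++ [(i, v)])

variable {E : Fin m → LinEqMod 2 n}

/-- The rows listed by a peeling order are exactly the family. [folklore] -/
theorem IsPeeling.mem_iff {I : Finset (Fin m)} {L : List (Fin m × Fin n)} (h : IsPeeling E I L)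
    {i : Fin m} : (∃ e ∈ L, e.1 = i) ↔ i ∈ I := by
  induction h with
  | nil => simp
  | snoc i₀ v _ _ _ _ ih =>
    simp only [List.mem_append, List.mem_singleton, Finset.mem_insert]
    constructor
    · rintro ⟨e, he | rfl, rfl⟩
      · exact Or.inr (ih.1 ⟨e, he, rfl⟩)
      · exact Or.inl rfl
    · rintro (rfl | hi)
      · exact ⟨(_, v), Or.inr rfl, rfl⟩
      · obtain ⟨e, he, rfl⟩ := ih.2 hi
        exact ⟨e, Or.inl he, rfl⟩

/-- Pivots lie in the supports of their rows. [folklore] -/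
theorem IsPeeling.pivot_mem_supp {I : Finset (Fin m)} {L : List (Fin m × Fin n)} (h : IsPeeling E I L)
    {e : Fin m × Fin n} (he : e ∈ L) : e.2 ∈ (E e.1).supp := by
  induction h with
  | nil => simp at he
  | snoc i v _ _ hv _ ih =>
    rcases List.mem_append.1 he with he | he
    · exact ih he
    · rw [List.mem_singleton] at he; subst he; exact hv

/-- The length of a peeling order is the size of the family. [folklore] -/
theorem IsPeeling.length_eq {I : Finset (Fin m)} {L : List (Fin m × Fin n)} (h : IsPeeling E I L) :
    L.length = I.card := by
  induction h with
  | nil => simp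
  | snoc i v _ hi _ _ ih => rw [List.length_append, Finset.card_insert_of_notMem hi, ih]; rfl

/-- The pivots of a peeling order are pairwise distinct. [folklore] -/
theorem IsPeeling.nodup_pivots {I : Finset (Fin m)} {L : List (Fin m × Fin n)} (h : IsPeeling E I L) :
    (L.map Prod.snd).Nodup := by
  induction h with
  | nil => simp
  | snoc i v hL _ _ hfresh ih =>
    rw [List.map_append, List.nodup_append]
    refine ⟨ih, by simp, ?_⟩
    intro w hw w' hw'
    simp only [List.map_cons, List.map_nil, List.mem_singleton] at hw'
    subst hw'
    obtain ⟨e, he, rfl⟩ := List.mem_map.1 hw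
    intro heq
    have h1 : e.2 ∈ (E e.1).supp := hL.pivot_mem_supp he
    have h2 : e.1 ∈ _ := hL.mem_iff.1 ⟨e, he, rfl⟩
    exact hfresh e.1 h2 (heq ▸ h1)

/-- **Existence of peeling orders avoiding a set.** If every subfamily `I' ⊆ I` has at least
`c|I'|` unique-neighbour variables (`c > 0`), then for every set `W` of variables there is a
peeling order of `I` with at most `|W|/c` pivots in `W`: peel a unique neighbour outside `W`
(putting its row last) while one exists; when `∂I' ⊆ W` the remaining family has `≤ |W|/c` rows.
[Alekhnovich 2011, §3] [folklore] -/
theorem exists_isPeeling_avoiding {c : ℝ} (hc : 0 < c) (I : Finset (Fin m))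
    (hexpI : ∀ I' ⊆ I, c * I'.card ≤ ((boundary (fun i => (E i).supp.map Fin.valEmbedding) I').card : ℝ))
    (W : Finset ℕ) :
    ∃ L, IsPeeling E I L ∧ c * ((L.filter fun e => ((e.2 : ℕ) ∈ W)).length : ℝ) ≤ W.card := by
  induction I using Finset.strongInduction with
  | H I ih =>
    rcases I.eq_empty_or_nonempty with rfl | hne
    · exact ⟨[], IsPeeling.nil, by simp⟩
    -- a unique-neighbour variable of `I`, preferably outside `W`
    have hbdI : (boundary (fun i => (E i).supp.map Fin.valEmbedding) I).Nonempty := by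
      rw [← Finset.card_pos]
      have h1 := hexpI I subset_rfl
      have h2 : (0 : ℝ) < c * I.card := mul_pos hc (by exact_mod_cast Finset.card_pos.2 hne)
      exact_mod_cast h2.trans_le h1
    -- generic peeling step: any boundary variable `x` of `I` can be peeled last
    have peel : ∀ x ∈ boundary (fun i => (E i).supp.map Fin.valEmbedding) I,
        ∃ (i : Fin m) (v : Fin n) (L₀ : List (Fin m × Fin n)), i ∈ I ∧ (v : ℕ) = x ∧
          IsPeeling E I (L₀ ++ [(i, v)]) ∧
          c * ((L₀.filter fun e => ((e.2 : ℕ) ∈ W)).length : ℝ) ≤ W.card := by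
      intro x hx
      obtain ⟨i, hi, v, hvx, hvi, huniq⟩ := exists_unique_row_of_mem_boundary E hx
      obtain ⟨L₀, hL₀, hW₀⟩ := ih (I.erase i) (Finset.erase_ssubset hi)
        (fun I' hI' => hexpI I' (hI'.trans (Finset.erase_subset _ _)))
      refine ⟨i, v, L₀, hi, hvx, ?_, hW₀⟩
      have := IsPeeling.snoc i v hL₀ (by simp) hvi (fun i' hi' hvi' => ?_)
      · rwa [Finset.insert_erase hi] at this
      · exact (Finset.mem_erase.1 hi').1 (huniq i' (Finset.mem_erase.1 hi').2 hvi')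
    by_cases hout : ∃ x ∈ boundary (fun i => (E i).supp.map Fin.valEmbedding) I, x ∉ W
    · obtain ⟨x, hx, hxW⟩ := hout
      obtain ⟨i, v, L₀, -, hvx, hL, hW₀⟩ := peel x hx
      refine ⟨L₀ ++ [(i, v)], hL, ?_⟩
      rw [List.filter_append]
      have : [(i, v)].filter (fun e => ((e.2 : ℕ) ∈ W)) = [] := by
        simp [hvx, hxW]
      rw [this, List.append_nil]
      exact hW₀
    · push Not at hout
      obtain ⟨x, hx⟩ := hbdI
      obtain ⟨i, v, L₀, -, -, hL, -⟩ := peel x hx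
      refine ⟨L₀ ++ [(i, v)], hL, ?_⟩
      have h1 : ((L₀ ++ [(i, v)]).filter fun e => ((e.2 : ℕ) ∈ W)).length ≤ I.card := by
        rw [← hL.length_eq]; exact List.length_filter_le _ _
      have h2 : (boundary (fun i => (E i).supp.map Fin.valEmbedding) I).card ≤ W.card :=
        Finset.card_le_card fun y hy => hout y hy
      calc c * (((L₀ ++ [(i, v)]).filter fun e => ((e.2 : ℕ) ∈ W)).length : ℝ)
          ≤ c * I.card := by gcongr
        _ ≤ (boundary (fun i => (E i).supp.map Fin.valEmbedding) I).card := hexpI I subset_rfl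
        _ ≤ W.card := by exact_mod_cast h2

/-! ### The solving map -/

/-- One step of the solving map: flip the pivot `e.2` if row `e.1` is violated. [folklore] -/
noncomputable def flipStep (E : Fin m → LinEqMod 2 n) (e : Fin m × Fin n) (τ : ℕ → Bool) : ℕ → Bool :=
  if (E e.1).Holds (blockVals 2 1 n τ) then τ else Function.update τ e.2 (!τ e.2)

/-- The SOLVING MAP along a list of (row, pivot) pairs: process the rows in order, flipping the
pivot of every violated row. [Alekhnovich 2011, §3 (extending to a solution of the closure)]
[folklore] -/
noncomputable def solve (E : Fin m → LinEqMod 2 n) (L : List (Fin m × Fin n)) (σ : ℕ → Bool) :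
    ℕ → Bool :=
  L.foldl (fun τ e => flipStep E e τ) σ

/-- Unfolding `solve` along an appended pair. [folklore] -/
theorem solve_append_singleton (L : List (Fin m × Fin n)) (e : Fin m × Fin n) (σ : ℕ → Bool) :
    solve E (L ++ [e]) σ = flipStep E e (solve E L σ) := by
  simp [solve, List.foldl_append]

/-- After a flip step the row holds. [folklore] -/
theorem holds_flipStep {e : Fin m × Fin n} (he : e.2 ∈ (E e.1).supp) (τ : ℕ → Bool) :
    (E e.1).Holds (blockVals 2 1 n (flipStep E e τ)) := by
  unfold flipStep
  split_ifs with h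
  · exact h
  · exact holds_blockVals_update_not _ τ he h

/-- A flip step changes at most the pivot. [folklore] -/
theorem flipStep_apply_of_ne {e : Fin m × Fin n} (τ : ℕ → Bool) {x : ℕ} (hx : (e.2 : ℕ) ≠ x) :
    flipStep E e τ x = τ x := by
  unfold flipStep
  split_ifs
  · rfl
  · exact Function.update_of_ne (Ne.symm hx) _ _

/-- `solve` changes only pivots. [folklore] -/
theorem solve_apply_of_forall_ne (L : List (Fin m × Fin n)) (σ : ℕ → Bool) {x : ℕ}
    (hx : ∀ e ∈ L, (e.2 : ℕ) ≠ x) : solve E L σ x = σ x := by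
  induction L using List.reverseRecOn with
  | nil => rfl
  | append_singleton L e ih =>
    rw [solve_append_singleton, flipStep_apply_of_ne _ (hx e (by simp)),
      ih fun e' he' => hx e' (by simp [he'])]

/-- In particular `solve` changes no variable `≥ n`. [folklore] -/
theorem solve_apply_of_le (L : List (Fin m × Fin n)) (σ : ℕ → Bool) {x : ℕ} (hx : n ≤ x) :
    solve E L σ x = σ x :=
  solve_apply_of_forall_ne L σ fun e _ h => by have := e.2.2; omega

/-- **`solve` solves**: along a peeling order of `I`, the result satisfies every row of `I`
(later flips touch pivots outside the supports of earlier rows). [Alekhnovich 2011, §3] [folklore] -/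
theorem holds_solve {I : Finset (Fin m)} {L : List (Fin m × Fin n)} (h : IsPeeling E I L)
    (σ : ℕ → Bool) : ∀ i ∈ I, (E i).Holds (blockVals 2 1 n (solve E L σ)) := by
  induction h with
  | nil => simp
  | snoc i v hL hi hv hfresh ih =>
    intro i' hi'
    rw [solve_append_singleton]
    rcases Finset.mem_insert.1 hi' with rfl | hi'
    · exact holds_flipStep (e := (_, v)) hv _
    · unfold flipStep
      split_ifs
      · exact ih i' hi'
      · rw [holds_blockVals_update_iff]
        · exact ih i' hi'
        · intro j hj heq
          obtain rfl : j = v := Fin.ext heq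
          exact hfresh i' hi' hj

/-- **Uniqueness**: if `x` solves every row of `I` and `y` agrees with `x` off the pivots of a
peeling order `L` of `I`, then `solve E L y = x`. [Alekhnovich 2011, §3] [folklore] -/
theorem solve_eq_of_agree_off_pivots {I : Finset (Fin m)} {L : List (Fin m × Fin n)}
    (h : IsPeeling E I L) {x y : ℕ → Bool} (hx : ∀ i ∈ I, (E i).Holds (blockVals 2 1 n x))
    (hxy : ∀ w, (∀ e ∈ L, (e.2 : ℕ) ≠ w) → y w = x w) : solve E L y = x := by
  induction h generalizing x y with
  | nil =>
    funext w
    exact hxy w (by simp)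
  | @snoc I L i v hL hi hv hfresh ih =>
    -- the prefix solves the old rows with target `x' = x[v := y v]`
    set x' : ℕ → Bool := Function.update x v (y v) with hx'
    have hx'rows : ∀ i' ∈ I, (E i').Holds (blockVals 2 1 n x') := by
      intro i' hi'
      rw [hx', holds_blockVals_update_iff]
      · exact hx i' (Finset.mem_insert_of_mem hi')
      · intro j hj heq
        obtain rfl : j = v := Fin.ext heq
        exact hfresh i' hi' hj
    have hyx' : ∀ w, (∀ e ∈ L, (e.2 : ℕ) ≠ w) → y w = x' w := by
      intro w hw
      by_cases hwv : w = v
      · subst hwv; rw [hx', Function.update_self]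
      · rw [hx', Function.update_of_ne hwv]
        exact hxy w fun e he => by
          rcases List.mem_append.1 he with he | he
          · exact hw e he
          · rw [List.mem_singleton] at he; subst he; exact Ne.symm hwv
    have hpre : solve E L y = x' := ih hx'rows hyx'
    rw [solve_append_singleton, hpre]
    have hxi : (E i).Holds (blockVals 2 1 n x) := hx i (Finset.mem_insert_self _ _)
    by_cases hyv : y v = x v
    · have : x' = x := by rw [hx', hyv, Function.update_eq_self]
      rw [this]
      unfold flipStep
      rw [if_pos hxi]
    · have hne : y v = !x v := Bool.eq_not_iff.mpr hyv
      have hx'eq : x' = Function.update x v (!x v) := by rw [hx', hne]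
      have hviol : ¬ (E i).Holds (blockVals 2 1 n x') := by
        rw [hx'eq, holds_update_not_iff x hv]; exact fun h => h hxi
      unfold flipStep
      rw [if_neg hviol]
      change Function.update x' v (!x' v) = x
      rw [hx'eq, Function.update_self, Function.update_idem, Bool.not_not, Function.update_eq_self]

/-- A solution is a fixed point of `solve`. [folklore] -/
theorem solve_eq_self {I : Finset (Fin m)} {L : List (Fin m × Fin n)} (h : IsPeeling E I L)
    {x : ℕ → Bool} (hx : ∀ i ∈ I, (E i).Holds (blockVals 2 1 n x)) : solve E L x = x :=
  solve_eq_of_agree_off_pivots h hx fun _ _ => rfl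

end Summit.PneNP.PneNP.Theorems.ResKRestriction
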